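import Literature.MathematicalPhysics.QuantumFieldTheory.BalabanImbrieJaffe1984to88.BIJ88PolyInteractionBounds308

/-!
# `BalabanImbrieJaffe1984to88.BIJ88PolyInteractionLimits308` — T. Bałaban, J. Imbrie, A. Jaffe, *Effective action and cluster
properties of the abelian Higgs model*, Commun. Math. Phys. **114** (1988) 257–315 [BalabanImbrieJaffe1988]: Sect. 5.14, pp. 308–309
[PDF 52–53], verbatim (v1.1: p. 309 re-read as an IMAGE): p. 308 *"Thus the restrictions and the interactions disappear at t = 0, at which point we
have a purely Gaussian
expectation. Thus we define perturbative terms for the action, 𝒫_{k+1}(Λ₁₂^{(k)}) = Σ_{α=1}^{n̄} −(1/α!)(dᵅ/dtᵅ) log z_t(Λ₁₂^{(k)})|_{t=0}"*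
(5.14.1); p. 309 *"using the fact that V^{(k)}(Y) is a small polynomial in A^{(k)}, φ^{(k)}. [The restrictions disappear as t → 0, so
V^{(k)}(Y) cannot be replaced by its supremum.]"* — the LIMITS `t → 0⁺` of all t-derivatives of `z(t) = ∫ χ′_{Λ,t}e^{−tW} dP` and of
`log z(t)` for a POLYNOMIALLY BOUNDED interaction `|W| ≤ K(1 + Σ_{b∈Λ}|Φ_b|)^m` (sequel of `BIJ88PolyInteraction308` /
`BIJ88PolyInteractionBounds308`; the bounded-`W` case is `BIJ88GaussianMoments308`).

statement-level skeleton of published theorems with citation tags; proofs where landed; nothing here is a claim about the Yang–Mills mass gap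

ERRATUM (v1.1, docstring only; referee ref-5 gen 28 ASK (a); p. 309 re-read as an IMAGE, `lit-balaban-ref-1/renders/cmp114/original-p053-x2.png`):
print reads *"… using the fact that V^{(k)}(Y) is a small polynomial in A^{(k)}, φ^{(k)}"* — NO tilde on `V^{(k)}(Y)` (v1 put one;
`Ṽ^{(k)}` is only the sum `Ṽ^{(k)}(Λ₁₂^{(k)}) = Σ_Y V^{(k)}(Y)` of (5.14.1)).  Declarations are unchanged.

WHAT THIS FILE ADDS (theorems only; no definitions, no `Prop` facts; axioms standard).
**`z^{(n)}(t) → ∫ (−W)ⁿ dP` for EVERY `n`** (`tendsto_iteratedDeriv_integral_polyInteraction_zero`: dominated convergence with the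
t-uniform integrable bound `e^{KK′}Kⁿ(1 + Σ|Φ_b|)^{mn}` for the `i = 0` Leibniz term — `V` is NOT replaced by a supremum — and the Gaussian
shell factor `t^{−i}e^{−κp(te_k)²}` beating the polynomial `(1 + C p(te_k))^{mn}` for the `i ≥ 1` terms), `z_t → 1`, and
**`(dᵅ/dtᵅ) log z_t → κ_α(−W) = Σ_{c : OrderedFinpartition α} log^{(|c|)}(1)·Π_j ∫ (−W)^{|c_j|} dP`**
(`tendsto_iteratedDeriv_log_polyInteraction_zero`, Faà di Bruno; the cumulant is written through the moments since `E e^{−tW}` need not be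
finite for a polynomial `W`).

PDF held: `paper:balaban1988-cmp114-bij-abelian-higgs-effective-action` (journal page = PDF page + 256); pp. 308–309 [PDF 52–53].

CITATION HEADER (lean-in-tree rule).  Part of the lit-balaban TYPED SKELETON (HOME `run/shared/lean/pub/lit-balaban/`), Phase 2,
seat p36 (gen 8, unit `lit-balaban-p36`); rows **C2.Eq5.14.1-5.14.2** and **C2.Eq5.14.3-5.14.4** (p. 309 sentences) of
`HOME/lit-balaban-r16/ROWS-C2-part2.md` (owner r16; typed leaves untouched).
-/

namespace Literature.MathematicalPhysics.QuantumFieldTheory.BalabanImbrieJaffe1984to88.BIJ88PolyInteractionLimits308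

open MeasureTheory ProbabilityTheory Filter Set
open scoped Topology
open BIJ88Sect2Statements (pLog)
open BIJ88Sect5Statements (CutoffProfile cutoff)
open BIJ88PolyInteractionBounds308 (integrable_one_add_sum_abs_pow abs_momentTerm_le abs_leibnizTerm_le
  one_add_mul_pow_mul_exp_neg_sq_le)

/-! ## §3 The limits `t → 0⁺`: Gaussian moments and cumulants of `−Ṽ` -/

section Limits

variable (χ : CutoffProfile) {ι Ω : Type*} [MeasurableSpace Ω]

/-- **The `i = 0` term: `∫ χ′_{Λ,t}(−W)ⁿe^{−tW} dP → ∫ (−W)ⁿ dP`** for a polynomially bounded interaction and Gaussian marginals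
(dominated convergence with the t-UNIFORM polynomial bound of `abs_momentTerm_le`). [cite: BalabanImbrieJaffe1988, (5.14.2) p.308] -/
theorem tendsto_integral_momentTerm_zero_poly {p : ℝ} (hp : 0 < p) (P : Measure Ω) [IsProbabilityMeasure P] (B : Finset ι)
    {Φ : ι → Ω → ℝ} (hG : ∀ b ∈ B, HasGaussianLaw (Φ b) P) (hΦ : ∀ b ∈ B, Measurable (Φ b)) {c : ι → ℝ}
    (hc : ∀ b ∈ B, 0 < c b) {W : Ω → ℝ} (hW : Measurable W) {K : ℝ} (hK : 0 ≤ K) {m : ℕ}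
    (hWg : ∀ ω, |W ω| ≤ K * (1 + ∑ b ∈ B, |Φ b ω|) ^ m) {ek : ℝ} (hek : 0 < ek) (n : ℕ) :
    Tendsto (fun t => ∫ ω, (∏ b ∈ B, cutoff χ (c b * pLog p (t * ek)) (Φ b ω)) * ((-W ω) ^ n * Real.exp (-(t * W ω))) ∂P)
      (𝓝[>] (0 : ℝ)) (𝓝 (∫ ω, (-W ω) ^ n ∂P)) := by
  set E : ℝ := Real.exp (K * (1 + (∑ b ∈ B, c b) * ((m : ℝ) * p + |Real.log ek|) ^ p) ^ m) with hE
  refine tendsto_integral_filter_of_dominated_convergence (fun ω => E * (K ^ n * (1 + ∑ b ∈ B, |Φ b ω|) ^ (m * n))) ?_ ?_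
    (((integrable_one_add_sum_abs_pow P B hG (m * n)).const_mul (K ^ n)).const_mul E) ?_
  · exact Filter.Eventually.of_forall fun t =>
      ((BIJ88InterpolatedRestrictions308.measurable_prod_cutoff_t χ p B hΦ c ek t).mul
        ((hW.neg.pow_const _).mul (Real.measurable_exp.comp (hW.const_mul t).neg))).aestronglyMeasurable
  · filter_upwards [BIJ88RestrictedInteraction308.eventually_branch ek] with t ht
    have hlt1 : t * ek < 1 := ht.2.2.trans (by rw [← Real.exp_zero]; exact Real.exp_lt_exp.mpr (by norm_num))
    exact Filter.Eventually.of_forall fun ω => by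
      rw [Real.norm_eq_abs]
      exact abs_momentTerm_le χ hp B Φ hc hK hWg hek ht.1 ht.2.1 hlt1 n ω
  · refine Filter.Eventually.of_forall fun ω => ?_
    have hP := tendsto_finsetProd B (f := fun b t => cutoff χ (c b * pLog p (t * ek)) (Φ b ω)) (a := fun _ => (1 : ℝ))
      (x := 𝓝[>] (0 : ℝ)) fun b hb => BIJ88RestrictionsVanish308.tendsto_cutoff_t_one χ (hc b hb) hp hek (Φ b ω)
    have hE' : Tendsto (fun t : ℝ => (-W ω) ^ n * Real.exp (-(t * W ω))) (𝓝[>] (0 : ℝ)) (𝓝 ((-W ω) ^ n * 1)) :=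
      ((BIJ88RestrictionsVanish308.tendsto_exp_interaction_one (W ω)).mono_left nhdsWithin_le_nhds).const_mul _
    simpa using hP.mul hE'

/-- **The `i ≥ 1` terms vanish**: `∫ (∂^i_tχ′_{Λ,t})(−W)ⁿe^{−tW} dP → 0` for a polynomially bounded interaction, centered Gaussian marginals
(variances `≤ v`), `c_b ≥ c₀ > 0`, `p > 1/2` — the Gaussian shell factor `t^{−i}e^{−κp(te_k)²}` beats the polynomial `(1 + Cp(te_k))^{mn}`.
[cite: BalabanImbrieJaffe1988, p.309 (Sect. 5.14)] -/
theorem tendsto_integral_mixedTerm_zero_poly {p : ℝ} (hp : 1 / 2 < p) (P : Measure Ω) [IsProbabilityMeasure P] (B : Finset ι)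
    {Φ : ι → Ω → ℝ} (hG : ∀ b ∈ B, HasGaussianLaw (Φ b) P) (hΦ : ∀ b ∈ B, Measurable (Φ b)) (h0 : ∀ b ∈ B, P[Φ b] = 0)
    {v : ℝ} (hv : 0 < v) (hvar : ∀ b ∈ B, Var[Φ b; P] ≤ v) {c : ι → ℝ} {c₀ : ℝ} (hc₀ : 0 < c₀) (hcb : ∀ b ∈ B, c₀ ≤ c b)
    {W : Ω → ℝ} {K : ℝ} (hK : 0 ≤ K) {m : ℕ} (hWg : ∀ ω, |W ω| ≤ K * (1 + ∑ b ∈ B, |Φ b ω|) ^ m) {ek : ℝ} (hek : 0 < ek)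
    {i : ℕ} (hi : 1 ≤ i) (n : ℕ) :
    Tendsto (fun t => ∫ ω, iteratedDeriv i (fun s => ∏ b ∈ B, cutoff χ (c b * pLog p (s * ek)) (Φ b ω)) t *
      ((-W ω) ^ n * Real.exp (-(t * W ω))) ∂P) (𝓝[>] (0 : ℝ)) (𝓝 0) := by
  have hp0 : 0 < p := by linarith
  have hc : ∀ b ∈ B, 0 < c b := fun b hb => hc₀.trans_le (hcb b hb)
  have hcne : ∀ b ∈ B, c b ≠ 0 := fun b hb => (hc b hb).ne'
  have hcabs : ∀ b ∈ B, c₀ ≤ |c b| := fun b hb => (hcb b hb).trans (le_abs_self _)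
  obtain ⟨C, hC1, hC⟩ :=
    BIJ88GaussIntegration309Law.integral_abs_iteratedDeriv_prod_cutoff_t_le_of_hasGaussianLaw (ι := ι) (Ω := Ω) χ p i
  obtain ⟨C', -, hC'⟩ := BIJ88GaussIntegration309Product.abs_iteratedDeriv_prod_cutoff_t_le (ι := ι) χ p i
  set κ : ℝ := 81 / 200 * (c₀ ^ 2 / v) with hκdef
  have hκ : 0 < κ := by positivity
  set Cs : ℝ := ∑ b ∈ B, c b with hCs
  have hCs0 : 0 ≤ Cs := Finset.sum_nonneg fun b hb => (hc b hb).le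
  set E : ℝ := Real.exp (K * (1 + Cs * ((m : ℝ) * p + |Real.log ek|) ^ p) ^ m) with hE
  set D : ℝ := (1 + Cs) ^ (m * n) * Real.exp (((m * n : ℕ) : ℝ) ^ 2 / (4 * (κ / 2))) with hD
  have hD0 : 0 ≤ D := by positivity
  -- the bound: E K^n (1 + Cs p)^{mn} (|B|C)^i t^{-i} 2|B| e^{-κp²} ≤ [E K^n D (|B|C)^i 2|B|] · t^{-i} e^{-(κ/2)p²}
  refine squeeze_zero_norm' (a := fun t => E * K ^ n * D * ((B.card : ℝ) * C) ^ i * (2 * B.card) *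
      (t ^ (-(i : ℤ)) * Real.exp (-(κ / 2 * pLog p (t * ek) ^ 2)))) ?_ ?_
  · filter_upwards [BIJ88RestrictedInteraction308.eventually_branch ek] with t ht
    have ht0 := ht.1
    have hlt1 : t * ek < 1 := ht.2.2.trans (by rw [← Real.exp_zero]; exact Real.exp_lt_exp.mpr (by norm_num))
    have hI := hC P B Φ c c₀ v hG hΦ h0 hv hvar hc₀ hcabs hek ht0 ht.2.2.le i hi le_rfl
    set Et : ℝ := E * (K * (1 + Cs * pLog p (t * ek)) ^ m) ^ n with hEt
    have hEt0 : 0 ≤ Et := by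
      have := BIJ88RestrictionsVanish308.pLog_nonneg p (t * ek); positivity
    have hpt : ∀ ω, |iteratedDeriv i (fun s => ∏ b ∈ B, cutoff χ (c b * pLog p (s * ek)) (Φ b ω)) t *
        ((-W ω) ^ n * Real.exp (-(t * W ω)))| ≤
        Et * |iteratedDeriv i (fun s => ∏ b ∈ B, cutoff χ (c b * pLog p (s * ek)) (Φ b ω)) t| := fun ω =>
      abs_leibnizTerm_le χ hp0 B Φ hc hK hWg hek ht0 ht.2.1 hlt1 i n ω
    have hmeasD := BIJ88RestrictionsAllOrders308.measurable_iteratedDeriv_prod_cutoff_t χ p B hΦ c hek i ht0 hlt1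
    have hDint : Integrable (fun ω => |iteratedDeriv i (fun s => ∏ b ∈ B, cutoff χ (c b * pLog p (s * ek)) (Φ b ω)) t|) P := by
      refine (integrable_const (((B.card : ℝ) * C') ^ i * t ^ (-(i : ℤ)))).mono' hmeasD.abs.aestronglyMeasurable ?_
      refine Filter.Eventually.of_forall fun ω => ?_
      rw [Real.norm_eq_abs, abs_abs]
      exact hC' B (fun b => Φ b ω) c hcne hek ht0 ht.2.2.le i le_rfl
    -- polynomial × Gaussian: (K(1+Cs p))^n e^{-κp²} ≤ K^n D e^{-(κ/2)p²}
    have hpoly : (K * (1 + Cs * pLog p (t * ek)) ^ m) ^ n * Real.exp (-(κ * pLog p (t * ek) ^ 2)) ≤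
        K ^ n * D * Real.exp (-(κ / 2 * pLog p (t * ek) ^ 2)) := by
      have hu := BIJ88RestrictionsVanish308.pLog_nonneg p (t * ek)
      have h := one_add_mul_pow_mul_exp_neg_sq_le hCs0 (by positivity : 0 < κ / 2) (m * n) hu
      have hsplit : Real.exp (-(κ * pLog p (t * ek) ^ 2)) =
          Real.exp (-(κ / 2 * pLog p (t * ek) ^ 2)) * Real.exp (-(κ / 2 * pLog p (t * ek) ^ 2)) := by
        rw [← Real.exp_add]; ring_nf
      rw [mul_pow, ← pow_mul, hsplit, ← mul_assoc]
      have h2 : K ^ n * (1 + Cs * pLog p (t * ek)) ^ (m * n) * Real.exp (-(κ / 2 * pLog p (t * ek) ^ 2)) ≤ K ^ n * D := by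
        rw [mul_assoc]
        exact mul_le_mul_of_nonneg_left h (pow_nonneg hK _)
      exact mul_le_mul_of_nonneg_right h2 (Real.exp_pos _).le
    rw [Real.norm_eq_abs]
    calc |∫ ω, iteratedDeriv i (fun s => ∏ b ∈ B, cutoff χ (c b * pLog p (s * ek)) (Φ b ω)) t *
            ((-W ω) ^ n * Real.exp (-(t * W ω))) ∂P|
        ≤ ∫ ω, |iteratedDeriv i (fun s => ∏ b ∈ B, cutoff χ (c b * pLog p (s * ek)) (Φ b ω)) t *
            ((-W ω) ^ n * Real.exp (-(t * W ω)))| ∂P := abs_integral_le_integral_abs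
      _ ≤ ∫ ω, Et * |iteratedDeriv i (fun s => ∏ b ∈ B, cutoff χ (c b * pLog p (s * ek)) (Φ b ω)) t| ∂P :=
          integral_mono_of_nonneg (Filter.Eventually.of_forall fun ω => abs_nonneg _) (hDint.const_mul _)
            (Filter.Eventually.of_forall fun ω => hpt ω)
      _ = Et * ∫ ω, |iteratedDeriv i (fun s => ∏ b ∈ B, cutoff χ (c b * pLog p (s * ek)) (Φ b ω)) t| ∂P := integral_const_mul _ _
      _ ≤ Et * (((B.card : ℝ) * C) ^ i * t ^ (-(i : ℤ)) * (2 * B.card * Real.exp (-(81 / 200 * (c₀ ^ 2 / v) * pLog p (t * ek) ^ 2)))) :=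
          mul_le_mul_of_nonneg_left hI hEt0
      _ = E * ((B.card : ℝ) * C) ^ i * (2 * B.card) * t ^ (-(i : ℤ)) *
            ((K * (1 + Cs * pLog p (t * ek)) ^ m) ^ n * Real.exp (-(κ * pLog p (t * ek) ^ 2))) := by
          rw [hEt, hκdef]; ring
      _ ≤ E * ((B.card : ℝ) * C) ^ i * (2 * B.card) * t ^ (-(i : ℤ)) * (K ^ n * D * Real.exp (-(κ / 2 * pLog p (t * ek) ^ 2))) :=
          mul_le_mul_of_nonneg_left hpoly (by
            have hC0 : 0 ≤ C := by linarith
            have hti : 0 < t ^ (-(i : ℤ)) := zpow_pos ht0 _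
            have hE0 : 0 < E := by rw [hE]; exact Real.exp_pos _
            exact mul_nonneg (mul_nonneg (mul_nonneg hE0.le (pow_nonneg (mul_nonneg (Nat.cast_nonneg _) hC0) _))
              (by positivity)) hti.le)
      _ = E * K ^ n * D * ((B.card : ℝ) * C) ^ i * (2 * B.card) *
            (t ^ (-(i : ℤ)) * Real.exp (-(κ / 2 * pLog p (t * ek) ^ 2))) := by ring
  · have h := (BIJ88RestrictionsAllOrders308.tendsto_zpow_mul_exp_neg_pLog_sq (half_pos hκ) hp hek i).const_mul
      (E * K ^ n * D * ((B.card : ℝ) * C) ^ i * (2 * B.card))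
    rw [mul_zero] at h
    exact h

/-- **Every Taylor coefficient of `z_t` at `t = 0⁺` is a Gaussian moment of `−Ṽ`, for a POLYNOMIALLY BOUNDED interaction**:
`z^{(n)}(t) → ∫ (−W)ⁿ dP` as `t → 0⁺`, every `n` (centered Gaussian marginals, variances `≤ v`, `c_b ≥ c₀ > 0`, `p > 1/2`, `e_k > 0`,
measurable `W` with `|W| ≤ K(1 + Σ|Φ_b|)^m`). [cite: BalabanImbrieJaffe1988, (5.14.1) p.308] -/
theorem tendsto_iteratedDeriv_integral_polyInteraction_zero {p : ℝ} (hp : 1 / 2 < p) (P : Measure Ω) [IsProbabilityMeasure P]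
    (B : Finset ι) {Φ : ι → Ω → ℝ} (hG : ∀ b ∈ B, HasGaussianLaw (Φ b) P) (hΦ : ∀ b ∈ B, Measurable (Φ b))
    (h0 : ∀ b ∈ B, P[Φ b] = 0) {v : ℝ} (hv : 0 < v) (hvar : ∀ b ∈ B, Var[Φ b; P] ≤ v) {c : ι → ℝ} {c₀ : ℝ} (hc₀ : 0 < c₀)
    (hcb : ∀ b ∈ B, c₀ ≤ c b) {W : Ω → ℝ} (hW : Measurable W) {K : ℝ} (hK : 0 ≤ K) {m : ℕ}
    (hWg : ∀ ω, |W ω| ≤ K * (1 + ∑ b ∈ B, |Φ b ω|) ^ m) {ek : ℝ} (hek : 0 < ek) (n : ℕ) :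
    Tendsto (fun t => iteratedDeriv n
        (fun t => ∫ ω, (∏ b ∈ B, cutoff χ (c b * pLog p (t * ek)) (Φ b ω)) * Real.exp (-(t * W ω)) ∂P) t)
      (𝓝[>] (0 : ℝ)) (𝓝 (∫ ω, (-W ω) ^ n ∂P)) := by
  have hp0 : 0 < p := by linarith
  have hc : ∀ b ∈ B, 0 < c b := fun b hb => hc₀.trans_le (hcb b hb)
  have hsum : Tendsto (fun t => ∑ i ∈ Finset.range (n + 1), (n.choose i : ℝ) *
      ∫ ω, iteratedDeriv i (fun s => ∏ b ∈ B, cutoff χ (c b * pLog p (s * ek)) (Φ b ω)) t *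
        ((-W ω) ^ (n - i) * Real.exp (-(t * W ω))) ∂P) (𝓝[>] (0 : ℝ))
      (𝓝 (∑ i ∈ Finset.range (n + 1), if i = 0 then ∫ ω, (-W ω) ^ n ∂P else 0)) := by
    refine tendsto_finsetSum _ fun i hi => ?_
    rcases Nat.eq_zero_or_pos i with h | h
    · subst h
      simp only [Nat.choose_zero_right, Nat.cast_one, one_mul, iteratedDeriv_zero, Nat.sub_zero, if_true]
      exact tendsto_integral_momentTerm_zero_poly χ hp0 P B hG hΦ hc hW hK hWg hek n
    · rw [if_neg h.ne']
      have h := (tendsto_integral_mixedTerm_zero_poly χ hp P B hG hΦ h0 hv hvar hc₀ hcb hK hWg hek h (n - i)).const_mul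
        (n.choose i : ℝ)
      rw [mul_zero] at h
      exact h
  rw [Finset.sum_ite_eq' (Finset.range (n + 1)) 0, if_pos (Finset.mem_range.mpr (Nat.succ_pos n))] at hsum
  refine hsum.congr' ?_
  filter_upwards [BIJ88RestrictedInteraction308.eventually_branch ek] with t ht
  have hlt1 : t * ek < 1 := ht.2.2.trans (by rw [← Real.exp_zero]; exact Real.exp_lt_exp.mpr (by norm_num))
  rw [BIJ88PolyInteraction308.iteratedDeriv_integral_polyInteraction χ hp0.le P B hΦ hc hW hK hWg hek n ht.1 ht.2.2]
  -- every Leibniz term is integrable at fixed t (bounded on the field box, zero outside)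
  have hint : ∀ i ∈ Finset.range (n + 1), Integrable (fun ω => (n.choose i : ℝ) *
      iteratedDeriv i (fun s => ∏ b ∈ B, cutoff χ (c b * pLog p (s * ek)) (Φ b ω)) t *
        ((-W ω) ^ (n - i) * Real.exp (-(t * W ω)))) P := by
    intro i hi
    obtain ⟨C', -, hC'⟩ := BIJ88GaussIntegration309Product.abs_iteratedDeriv_prod_cutoff_t_le (ι := ι) χ p i
    have hm := ((BIJ88RestrictionsAllOrders308.measurable_iteratedDeriv_prod_cutoff_t χ p B hΦ c hek i ht.1 hlt1).const_mul
      (n.choose i : ℝ)).mul ((hW.neg.pow_const (n - i)).mul (Real.measurable_exp.comp (hW.const_mul t).neg))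
    set Et : ℝ := Real.exp (K * (1 + (∑ b ∈ B, c b) * ((m : ℝ) * p + |Real.log ek|) ^ p) ^ m) *
      (K * (1 + (∑ b ∈ B, c b) * pLog p (t * ek)) ^ m) ^ (n - i) with hEt
    refine (integrable_const ((n.choose i : ℝ) * (Et * (((B.card : ℝ) * C') ^ i * t ^ (-(i : ℤ)))))).mono'
      hm.aestronglyMeasurable (Filter.Eventually.of_forall fun ω => ?_)
    have hD := hC' B (fun b => Φ b ω) c (fun b hb => (hc b hb).ne') hek ht.1 ht.2.2.le i le_rfl
    have hL := abs_leibnizTerm_le χ hp0 B Φ hc hK hWg hek ht.1 ht.2.1 hlt1 i (n - i) ω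
    have hEt0 : 0 ≤ Et := by
      have := BIJ88RestrictionsVanish308.pLog_nonneg p (t * ek)
      have hCs : 0 ≤ ∑ b ∈ B, c b := Finset.sum_nonneg fun b hb => (hc b hb).le
      positivity
    rw [Real.norm_eq_abs, mul_assoc, abs_mul, Nat.abs_cast]
    refine mul_le_mul_of_nonneg_left (hL.trans ?_) (Nat.cast_nonneg _)
    rw [← hEt]
    exact mul_le_mul_of_nonneg_left hD hEt0
  have hleib : (∫ ω, iteratedDeriv n
      (fun s => (∏ b ∈ B, cutoff χ (c b * pLog p (s * ek)) (Φ b ω)) * Real.exp (-(s * W ω))) t ∂P) =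
      ∫ ω, ∑ i ∈ Finset.range (n + 1), (n.choose i : ℝ) *
        iteratedDeriv i (fun s => ∏ b ∈ B, cutoff χ (c b * pLog p (s * ek)) (Φ b ω)) t *
          ((-W ω) ^ (n - i) * Real.exp (-(t * W ω))) ∂P :=
    integral_congr_ae (Filter.Eventually.of_forall fun ω =>
      BIJ88RestrictedInteractionAllOrders308.iteratedDeriv_restrictedInteraction χ p B (fun b => Φ b ω) c (W ω) hek ht.1 hlt1 n)
  rw [hleib, integral_finsetSum _ hint]
  refine Finset.sum_congr rfl fun i _ => ?_
  rw [← integral_const_mul]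
  refine integral_congr_ae (Filter.Eventually.of_forall fun ω => ?_)
  ring

/-- In particular `z_t → 1` as `t → 0⁺` (`n = 0`): *"a purely Gaussian expectation"*. [cite: BalabanImbrieJaffe1988, (5.14.2) p.308] -/
theorem tendsto_integral_polyInteraction_one {p : ℝ} (hp : 1 / 2 < p) (P : Measure Ω) [IsProbabilityMeasure P]
    (B : Finset ι) {Φ : ι → Ω → ℝ} (hG : ∀ b ∈ B, HasGaussianLaw (Φ b) P) (hΦ : ∀ b ∈ B, Measurable (Φ b))
    (h0 : ∀ b ∈ B, P[Φ b] = 0) {v : ℝ} (hv : 0 < v) (hvar : ∀ b ∈ B, Var[Φ b; P] ≤ v) {c : ι → ℝ} {c₀ : ℝ} (hc₀ : 0 < c₀)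
    (hcb : ∀ b ∈ B, c₀ ≤ c b) {W : Ω → ℝ} (hW : Measurable W) {K : ℝ} (hK : 0 ≤ K) {m : ℕ}
    (hWg : ∀ ω, |W ω| ≤ K * (1 + ∑ b ∈ B, |Φ b ω|) ^ m) {ek : ℝ} (hek : 0 < ek) :
    Tendsto (fun t => ∫ ω, (∏ b ∈ B, cutoff χ (c b * pLog p (t * ek)) (Φ b ω)) * Real.exp (-(t * W ω)) ∂P)
      (𝓝[>] (0 : ℝ)) (𝓝 1) := by
  have h := tendsto_iteratedDeriv_integral_polyInteraction_zero χ hp P B hG hΦ h0 hv hvar hc₀ hcb hW hK hWg hek 0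
  simpa only [iteratedDeriv_zero, pow_zero, integral_const, probReal_univ, smul_eq_mul, mul_one] using h

/-- **(5.14.1) for POLYNOMIALLY BOUNDED interactions: `(dᵅ/dtᵅ) log z_t → κ_α(−W)` as `t → 0⁺`**, the `α`-th cumulant of `−Ṽ` in the
Gaussian (`t = 0`) measure written through the moments (moment–cumulant formula = Faà di Bruno for `log`):
`κ_α = Σ_{c : OrderedFinpartition α} log^{(|c|)}(1)·Π_j ∫ (−W)^{|c_j|} dP` (hypotheses as above).
[cite: BalabanImbrieJaffe1988, (5.14.1) p.308] -/
theorem tendsto_iteratedDeriv_log_polyInteraction_zero {p : ℝ} (hp : 1 / 2 < p) (P : Measure Ω) [IsProbabilityMeasure P]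
    (B : Finset ι) {Φ : ι → Ω → ℝ} (hG : ∀ b ∈ B, HasGaussianLaw (Φ b) P) (hΦ : ∀ b ∈ B, Measurable (Φ b))
    (h0 : ∀ b ∈ B, P[Φ b] = 0) {v : ℝ} (hv : 0 < v) (hvar : ∀ b ∈ B, Var[Φ b; P] ≤ v) {c : ι → ℝ} {c₀ : ℝ} (hc₀ : 0 < c₀)
    (hcb : ∀ b ∈ B, c₀ ≤ c b) {W : Ω → ℝ} (hW : Measurable W) {K : ℝ} (hK : 0 ≤ K) {m : ℕ}
    (hWg : ∀ ω, |W ω| ≤ K * (1 + ∑ b ∈ B, |Φ b ω|) ^ m) {ek : ℝ} (hek : 0 < ek) (α : ℕ) :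
    Tendsto (fun t => iteratedDeriv α (fun t => Real.log
        (∫ ω, (∏ b ∈ B, cutoff χ (c b * pLog p (t * ek)) (Φ b ω)) * Real.exp (-(t * W ω)) ∂P)) t)
      (𝓝[>] (0 : ℝ))
      (𝓝 (∑ c' : OrderedFinpartition α, iteratedDeriv c'.length Real.log 1 * ∏ j, ∫ ω, (-W ω) ^ c'.partSize j ∂P)) := by
  have hp0 : 0 < p := by linarith
  have hc : ∀ b ∈ B, 0 < c b := fun b hb => hc₀.trans_le (hcb b hb)
  set z : ℝ → ℝ := fun t => ∫ ω, (∏ b ∈ B, cutoff χ (c b * pLog p (t * ek)) (Φ b ω)) * Real.exp (-(t * W ω)) ∂P with hzdef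
  have hz1 : Tendsto z (𝓝[>] (0 : ℝ)) (𝓝 1) :=
    tendsto_integral_polyInteraction_one χ hp P B hG hΦ h0 hv hvar hc₀ hcb hW hK hWg hek
  have hzne : ∀ᶠ t in 𝓝[>] (0 : ℝ), z t ≠ 0 :=
    (hz1.eventually (lt_mem_nhds (by norm_num : (1 : ℝ) / 2 < 1))).mono fun t ht h => by rw [h] at ht; linarith
  have hterm : ∀ c' : OrderedFinpartition α,
      Tendsto (fun t => iteratedDeriv c'.length Real.log (z t) * ∏ j, iteratedDeriv (c'.partSize j) z t) (𝓝[>] (0 : ℝ))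
        (𝓝 (iteratedDeriv c'.length Real.log 1 * ∏ j, ∫ ω, (-W ω) ^ c'.partSize j ∂P)) := by
    intro c'
    refine ((BIJ88LogZt308.continuousAt_iteratedDeriv_log_one c'.length).tendsto.comp hz1).mul ?_
    exact tendsto_finsetProd _ fun j _ =>
      tendsto_iteratedDeriv_integral_polyInteraction_zero χ hp P B hG hΦ h0 hv hvar hc₀ hcb hW hK hWg hek (c'.partSize j)
  have hsum := tendsto_finsetSum (Finset.univ : Finset (OrderedFinpartition α)) fun c' _ => hterm c'
  refine hsum.congr' ?_
  filter_upwards [hzne, BIJ88RestrictedInteraction308.eventually_branch ek] with t hzt ht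
  have hf := BIJ88PolyInteraction308.contDiffAt_integral_polyInteraction χ hp0.le P B hΦ hc hW hK hWg hek α ht.1 ht.2.2
  have hg : ContDiffAt ℝ (α : WithTop ℕ∞) Real.log (z t) := Real.contDiffAt_log.mpr hzt
  exact (iteratedDeriv_comp_eq_sum_orderedFinpartition (g := Real.log) hg hf le_rfl).symm

end Limits

end Literature.MathematicalPhysics.QuantumFieldTheory.BalabanImbrieJaffe1984to88.BIJ88PolyInteractionLimits308
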